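import Mathlib
import HarnessLib
import Summits.NavierStokesRegularity.NavierStokesRegularity.Theorems.ThreadingFluxPoloidalLiouvillePrecessionFastW1
import Summits.NavierStokesRegularity.NavierStokesRegularity.Theorems.ThreadingFluxPoloidalLiouvillePrecessionShortPeriodCollapse

/-!
# Route `ThreadingFlux`, item `PoloidalLiouville` (W1, stmt-NavierStokesRegularity-1222) — crux idea «precession-gap» (ns-idea-15): the W1 RUNG
# F `FastPrecessionPoloidalLiouville` is now UNCONDITIONAL

Cell ns-regularity-ideate, seat ns-poloidal-K2-p2 g13.  One application: the conditional rung
`…PrecessionFastW1.fastPrecessionPoloidalLiouville_of_shortPeriodCollapse` (p674652, K2-p2 g12: F from D) fed with the analysis lemma D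
`…PrecessionShortPeriodCollapse.shortPeriodCollapse` (this seat).  Statement = the body of `Precession.FastPrecessionPoloidalLiouville`
(`Cruxes/PoloidalLiouville/PrecessionSketch.lean` v2) VERBATIM up to unfolding the sketch-local `IsOseenMildOn (Iio 0) v` and `IsRotatingWave x₀ Ω V v`
(exactly as in p674652).

WHAT IT SAYS (honest): in the class of W1 (bounded ancient mild, smooth on `t < 0`, honest Oseen-mild on `(−∞,0)`, vortex lines tangent to the spheres about `x₀`),
a RIGIDLY PRECESSING state `v(t, x₀ + y) = R_{Ωt}V(R_{−Ωt}y)` with FAST precession `C‖V‖²_∞ ≤ |Ω|` has constant slices.  This DECIDES the fast half of the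
precessing stratum (non-existence); the slow half `|Ω| < C‖V‖²_∞` (containing the steady stratum) and W1 `stub_scalarLiouville` itself stay OPEN; movement on
1222 as an item = 0.  No claim about Navier–Stokes regularity.
-/

noncomputable section

-- the summit and its single sub-problem share the name (CONVENTIONS §1), as in every Theorems file
set_option linter.dupNamespace false

namespace Summit.NavierStokesRegularity.NavierStokesRegularity.Theorems.ThreadingFluxPoloidalLiouvillePrecessionFastW1Unconditional

open Set Function Filter Topology Metric MeasureTheory
open scoped RealInnerProductSpace InnerProductSpace
open Literature.Analysis Literature.Analysis.FluidPDE Literature.Analysis.UnboundedOperators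
open Summit.NavierStokesRegularity.NavierStokesRegularity.Theorems.ThreadingFluxPoloidalLiouvillePrecessionFastW1
open Summit.NavierStokesRegularity.NavierStokesRegularity.Theorems.ThreadingFluxPoloidalLiouvillePrecessionShortPeriodCollapse

/-- **W1 RUNG F `FastPrecessionPoloidalLiouville` (body VERBATIM, sketch-local definitions unfolded), UNCONDITIONAL**: fast-precessing rotating waves in the
class of `PoloidalLiouville` have constant slices.  `:= fastPrecessionPoloidalLiouville_of_shortPeriodCollapse shortPeriodCollapse`. -/
theorem fastPrecessionPoloidalLiouville :
    ∃ C : ℝ, 0 < C ∧ ∀ (v : ℝ → EuclideanSpace ℝ (Fin 3) → EuclideanSpace ℝ (Fin 3)) (x₀ : EuclideanSpace ℝ (Fin 3)) (Ω B : ℝ)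
      (V : EuclideanSpace ℝ (Fin 3) → EuclideanSpace ℝ (Fin 3)),
      IsBoundedAncientMildSolution 1 v → (∀ t < 0, AEStronglyMeasurable (v t) volume) →
      ContDiffOn ℝ (⊤ : ℕ∞) (uncurry v) (Iio 0 ×ˢ univ) →
      (∀ s ∈ Iio (0 : ℝ), ∀ t ∈ Iio (0 : ℝ), s < t → ∀ x,
        v t x = heatExtension (v s) (t - s) x - oseenDuhamel 1 s v v t x) →
      (∀ t x, v t x = rotZ (Ω * t) (V (rotZ (-(Ω * t)) (x - x₀)))) → (∀ x, ‖V x‖ ≤ B) → C * B ^ 2 ≤ |Ω| →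
      (∀ t < 0, ∀ x, inner ℝ (x - x₀) (curl (v t) x) = 0) →
      ∀ t < 0, ∃ b : EuclideanSpace ℝ (Fin 3), ∀ x, v t x = b :=
  fastPrecessionPoloidalLiouville_of_shortPeriodCollapse shortPeriodCollapse

end Summit.NavierStokesRegularity.NavierStokesRegularity.Theorems.ThreadingFluxPoloidalLiouvillePrecessionFastW1Unconditional

end
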